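import Mathlib.NumberTheory.Real.Irrational
import Literature.Computability.QuantumComplexity.StateVectorDP
import Literature.Computability.QuantumComplexity.ControlledHadamard
import HarnessLib

/-!
# The order `ℤ[ω]` in coordinates, continued: product, conjugation, unique coordinates, exact halving

Topic `Literature/Computability/QuantumComplexity`, continuing `StateVectorDP.lean` (`ZW = Fin 4 → ℤ`,
the coordinates of `a₀ + a₁ω + a₂ω² + a₃ω³ ∈ ℤ[ω]`, `ω = e^{iπ/4}`; `ZW.zwVal`, `zwVal_add`,
`ZW.one`, `mulOmega`, `mulOmegaPow`, the norm form `zwU`/`zwV`). The state-vector DP there only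
ever multiplies by powers of `ω`; the reduced-state (Gram) data of the `p`-blocked simulation of
Jozsa–Linden (`Literature/Barriers/QuantumAdvantage/BoundedEntanglement*.lean`, lemma `ratpbl`:
"we could allow the matrix elements to be members of a finite algebraic extension of the
rationals") need the full ring structure, complex conjugation, equality decided on coordinates
and exact division by `2^h`. This file adds, inside `namespace ZW`:

* `zwValHom` (evaluation as an additive hom) with `zwVal_neg`, `zwVal_sub`, `zwVal_zsmul`,
  `zwVal_sum`;
* **the product** `ZW.mul` (convolution with `ω⁴ = -1`) with `zwVal_mul`, and its algebra
  (`mul_comm`, `one_mul`, `mul_sum`, `sum_mul`, `mul_zsmul`) — NB `ZW` is the Pi type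
  `Fin 4 → ℤ`, whose pointwise `*` and `1` are NOT the ring structure of `ℤ[ω]`: write `ZW.mul`,
  `ZW.one`;
* **complex conjugation** `ZW.cconj` (`conj ω = -ω³`) with `zwVal_cconj`;
* **unique coordinates** `zwVal_injective`: `1, ω, ω², ω³` are linearly independent over `ℤ`
  (real and imaginary parts `a₀ + (a₁ - a₃)√2/2`, `a₂ + (a₁ + a₃)√2/2`, `zwVal_re`/`zwVal_im`, and
  the irrationality of `√2`), so equality in `ℂ` is decided on coordinates (`zwVal_inj`);
* exact division by powers of two `ZW.divPow` with `divPow_zsmul`, `divPow_eq_of_zwVal_eq`;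
* `conj_omega`, `omega_pow_three`.

## References

* R. Jozsa, N. Linden, *On the role of entanglement in quantum-computational speed-up*, Proc. R.
  Soc. Lond. A 459 (2003) 2011–2032, arXiv:quant-ph/0201143: §3, lemma `ratlemma` and the remark
  following it (exact arithmetic in a finite algebraic extension of `ℚ`).
* M. A. Nielsen, I. L. Chuang, *Quantum Computation and Quantum Information*, CUP 2010, §4.2
  (`T = diag(1, e^{iπ/4})`).
-/

noncomputable section

namespace Literature.Computability.QuantumComplexity

open _root_.Computability Complexity Cryptography

/-! ### Conjugate of `ω` -/

/-- `conj ω = -ω³` (`= ω⁷ = ω⁻¹`). [folklore] -/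
theorem conj_omega : starRingEnd ℂ omega = -omega ^ 3 := by
  rw [← omega_pow_seven, ← Complex.star_def]
  exact star_omega

/-- `ω³ = i ω`. [folklore] -/
theorem omega_pow_three : omega ^ 3 = Complex.I * omega := by
  rw [pow_succ, omega_pow_two]

namespace ZW

/-! ### Evaluation as an additive homomorphism -/

/-- Evaluation `zwVal` as an additive monoid homomorphism `ZW →+ ℂ`. [folklore] -/
def zwValHom : ZW →+ ℂ where
  toFun := zwVal
  map_zero' := zwVal_zero
  map_add' := zwVal_add

/-- `zwValHom` is `zwVal` (definitional). [folklore] -/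
@[simp] theorem zwValHom_apply (z : ZW) : zwValHom z = zwVal z := rfl

/-- Evaluation of a negation. [folklore] -/
theorem zwVal_neg (z : ZW) : zwVal (-z) = -zwVal z :=
  zwValHom.map_neg z

/-- Evaluation of a difference. [folklore] -/
theorem zwVal_sub (z w : ZW) : zwVal (z - w) = zwVal z - zwVal w :=
  zwValHom.map_sub z w

/-- Evaluation of an integer multiple. [folklore] -/
theorem zwVal_zsmul (n : ℤ) (z : ZW) : zwVal (n • z) = n * zwVal z := by
  rw [← zwValHom_apply, map_zsmul, zwValHom_apply, zsmul_eq_mul]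

/-- Evaluation of a finite sum. [folklore] -/
theorem zwVal_sum {ι : Type*} (s : Finset ι) (f : ι → ZW) : zwVal (∑ i ∈ s, f i) = ∑ i ∈ s, zwVal (f i) :=
  map_sum zwValHom f s

/-! ### The product -/

/-- **The product of `ℤ[ω]` in coordinates** (convolution with `ω⁴ = -1`). NB: `ZW = Fin 4 → ℤ`
carries the *pointwise* `*` of the Pi type, which is not this product — always write `ZW.mul`.
[cite: JozsaLinden2003, §3 (remark after lemma ratlemma)] -/
def mul (z w : ZW) : ZW :=
  ![z 0 * w 0 - z 1 * w 3 - z 2 * w 2 - z 3 * w 1,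
    z 0 * w 1 + z 1 * w 0 - z 2 * w 3 - z 3 * w 2,
    z 0 * w 2 + z 1 * w 1 + z 2 * w 0 - z 3 * w 3,
    z 0 * w 3 + z 1 * w 2 + z 2 * w 1 + z 3 * w 0]

/-- **Evaluation is multiplicative.** [folklore] -/
theorem zwVal_mul (z w : ZW) : zwVal (mul z w) = zwVal z * zwVal w := by
  have h4 := omega_pow_four
  simp only [zwVal_eq, mul, Matrix.cons_val_zero, Matrix.cons_val_one, Matrix.cons_val]
  push_cast
  linear_combination (-((z 1 * w 3 + z 2 * w 2 + z 3 * w 1 : ℂ) + (z 2 * w 3 + z 3 * w 2) * omega +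
    z 3 * w 3 * omega ^ 2)) * h4

/-- `mul` is commutative. [folklore] -/
protected theorem mul_comm (z w : ZW) : mul z w = mul w z := by
  ext k
  fin_cases k <;> simp [mul] <;> ring

/-- Left unit. [folklore] -/
@[simp] protected theorem one_mul (z : ZW) : mul one z = z := by
  ext k
  fin_cases k <;> simp [mul, one]

/-- Right unit. [folklore] -/
@[simp] protected theorem mul_one (z : ZW) : mul z one = z := by
  rw [ZW.mul_comm, ZW.one_mul]

/-- Left zero. [folklore] -/
@[simp] protected theorem zero_mul (z : ZW) : mul 0 z = 0 := by
  ext k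
  fin_cases k <;> simp [mul]

/-- Right zero. [folklore] -/
@[simp] protected theorem mul_zero (z : ZW) : mul z 0 = 0 := by
  ext k
  fin_cases k <;> simp [mul]

/-- `mul` distributes over finite sums on the right. [folklore] -/
theorem mul_sum {ι : Type*} (s : Finset ι) (z : ZW) (f : ι → ZW) :
    mul z (∑ i ∈ s, f i) = ∑ i ∈ s, mul z (f i) := by
  classical
  induction s using Finset.induction_on with
  | empty => simp
  | insert a s ha ih =>
    rw [Finset.sum_insert ha, Finset.sum_insert ha, ← ih]
    ext k
    fin_cases k <;> simp [mul] <;> ring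

/-- `mul` distributes over finite sums on the left. [folklore] -/
theorem sum_mul {ι : Type*} (s : Finset ι) (f : ι → ZW) (z : ZW) :
    mul (∑ i ∈ s, f i) z = ∑ i ∈ s, mul (f i) z := by
  rw [ZW.mul_comm, mul_sum]
  exact Finset.sum_congr rfl fun i _ => ZW.mul_comm _ _

/-- Integer multiples pull out of products. [folklore] -/
theorem mul_zsmul (n : ℤ) (z w : ZW) : mul z (n • w) = n • mul z w := by
  ext k
  fin_cases k <;> simp [mul] <;> ring

/-- `mulOmegaPow k one` evaluates to `ω^k`. [folklore] -/
theorem zwVal_mulOmegaPow_one (k : ℕ) : zwVal (mulOmegaPow k one) = omega ^ k := by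
  rw [zwVal_mulOmegaPow, zwVal_one, _root_.mul_one]

/-! ### Complex conjugation -/

/-- **Complex conjugation in coordinates**: `conj (z₀ + z₁ω + z₂ω² + z₃ω³) = z₀ - z₃ω - z₂ω² - z₁ω³`.
[folklore] -/
def cconj (z : ZW) : ZW := ![z 0, -z 3, -z 2, -z 1]

/-- **Evaluation commutes with conjugation.** [folklore] -/
theorem zwVal_cconj (z : ZW) : zwVal (cconj z) = starRingEnd ℂ (zwVal z) := by
  have h4 := omega_pow_four
  have hc := conj_omega
  simp only [zwVal_eq, cconj, Matrix.cons_val_zero, Matrix.cons_val_one, Matrix.cons_val, map_add,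
    map_mul, map_pow, map_intCast, hc]
  push_cast
  linear_combination ((z 3 : ℂ) * omega ^ 5 - z 3 * omega - z 2 * omega ^ 2) * h4

/-- Conjugation is an involution. [folklore] -/
@[simp] theorem cconj_cconj (z : ZW) : cconj (cconj z) = z := by
  ext k
  fin_cases k <;> simp [cconj]

/-! ### Unique coordinates: `1, ω, ω², ω³` are linearly independent over `ℤ` -/

/-- Real part of an element of `ℤ[ω]`: `z₀ + (z₁ - z₃) √2/2`. [folklore] -/
theorem zwVal_re (z : ZW) : (zwVal z).re = z 0 + (z 1 - z 3) * (Real.sqrt 2 / 2) := by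
  simp only [zwVal_eq, omega_pow_three, omega_pow_two, Complex.add_re, Complex.mul_re,
    Complex.intCast_re, Complex.intCast_im, Complex.I_re, Complex.I_im, omega_re, omega_im]
  ring

/-- Imaginary part of an element of `ℤ[ω]`: `z₂ + (z₁ + z₃) √2/2`. [folklore] -/
theorem zwVal_im (z : ZW) : (zwVal z).im = z 2 + (z 1 + z 3) * (Real.sqrt 2 / 2) := by
  simp only [zwVal_eq, omega_pow_three, omega_pow_two, Complex.add_im, Complex.mul_im,
    Complex.intCast_re, Complex.intCast_im, Complex.I_re, Complex.I_im, omega_re, omega_im]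
  ring

/-- `a + b √2/2 = 0` with integers `a`, `b` forces `a = b = 0` (irrationality of `√2`). [folklore] -/
theorem int_add_int_mul_sqrt_two_half_eq_zero {a b : ℤ} (h : (a : ℝ) + b * (Real.sqrt 2 / 2) = 0) :
    a = 0 ∧ b = 0 := by
  by_cases hb : b = 0
  · subst hb
    simp at h
    exact ⟨by exact_mod_cast h, rfl⟩
  · exfalso
    have hirr := (irrational_iff_ne_rational _).1 irrational_sqrt_two (-2 * a) b hb
    apply hirr
    have hb' : (b : ℝ) ≠ 0 := by exact_mod_cast hb
    field_simp
    push_cast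
    linarith

/-- **`1, ω, ω², ω³` are linearly independent over `ℤ`**: evaluation is injective, so an element of
`ℤ[ω]` has unique coordinates. [folklore] -/
theorem zwVal_injective : Function.Injective zwVal := by
  intro z w h
  have h0 : zwVal (z - w) = 0 := by rw [zwVal_sub, h, sub_self]
  have hre := zwVal_re (z - w)
  have him := zwVal_im (z - w)
  rw [h0] at hre him
  simp only [Complex.zero_re, Complex.zero_im, Pi.sub_apply, Int.cast_sub] at hre him
  obtain ⟨h1, h2⟩ := int_add_int_mul_sqrt_two_half_eq_zero
    (a := z 0 - w 0) (b := (z 1 - w 1) - (z 3 - w 3)) (by push_cast; linarith)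
  obtain ⟨h3, h4⟩ := int_add_int_mul_sqrt_two_half_eq_zero
    (a := z 2 - w 2) (b := (z 1 - w 1) + (z 3 - w 3)) (by push_cast; linarith)
  funext k
  fin_cases k
  · change z 0 = w 0
    omega
  · change z 1 = w 1
    omega
  · change z 2 = w 2
    omega
  · change z 3 = w 3
    omega

/-- Equality in `ℂ` is decided on coordinates. [folklore] -/
theorem zwVal_inj {z w : ZW} : zwVal z = zwVal w ↔ z = w :=
  zwVal_injective.eq_iff

/-- An element of `ℤ[ω]` vanishes iff its coordinates do. [folklore] -/
theorem zwVal_eq_zero_iff {z : ZW} : zwVal z = 0 ↔ z = 0 := by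
  rw [← zwVal_zero, zwVal_inj]

/-! ### Exact division by powers of two -/

/-- Coordinatewise division by `2^h` (integer division; exact on multiples of `2^h`). [folklore] -/
def divPow (h : ℕ) (z : ZW) : ZW := fun k => z k / 2 ^ h

/-- **Exactness**: `divPow h (2^h • z) = z`. [folklore] -/
theorem divPow_zsmul (h : ℕ) (z : ZW) : divPow h ((2 : ℤ) ^ h • z) = z := by
  funext k
  simp only [divPow, Pi.smul_apply, smul_eq_mul]
  exact Int.mul_ediv_cancel_left _ (pow_ne_zero h two_ne_zero)

/-- If `zwVal w = 2^h · zwVal z` then `divPow h w = z` (how the merge step of the `p`-blocked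
simulation recovers the data of a union of blocks exactly). [cite: JozsaLinden2003, §3 (proof of lemma ratpbl, Case 2)] -/
theorem divPow_eq_of_zwVal_eq (h : ℕ) {w z : ZW} (hw : zwVal w = (2 : ℂ) ^ h * zwVal z) :
    divPow h w = z := by
  have : w = (2 : ℤ) ^ h • z := zwVal_injective (by rw [zwVal_zsmul, hw]; push_cast; ring)
  rw [this, divPow_zsmul]

end ZW

end Literature.Computability.QuantumComplexity

end
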